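import Mathlib.Algebra.Order.BigOperators.Group.Finset
import Mathlib.Algebra.BigOperators.Group.Finset.Sigma
import Mathlib.Order.Interval.Finset.Nat
import HarnessLib

/-!
# Window counts, run tops and the discrete coarea bound (helper toward `StackingLiminf`,
# stmt-Ventures-19145, line "density Brunn–Minkowski")

Cell `crystal3d-full`, venture `Summits/Ventures/Crystal3D`.  Pure finite combinatorics in an additive
commutative group `G` (used with `G = ℤ × ℤ` per layer and `G = ℤ × ℤ × ℤ` for the fcc index lattice).

For a finite configuration `X ⊆ G`, a translation `v` and a finite WINDOW `B ⊆ G`: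
* the `v`-RUN TOPS of `X` are the points `x ∈ X` with `x + v ∉ X` (= the broken bonds `(x, x+v)`);
  for the fcc chain functional the contact deficiency `6N − #contacts` is exactly the number of run
  tops summed over the six bond directions (file `…StackingLiminfRunCount.lean`);
* the WINDOW COUNT `c(x) = #{b ∈ B : x + b ∈ X} = #(X ∩ (x + B))` is the (un-normalised) density of
  `X` at scale `B` around `x`.

Results (all exact, no asymptotics):
* `card_filter_window_le` — one-step descent: `c(x) ≤ c(x+v) + #{b ∈ B : x + b is a v-run top}`;
* `sum_window_tsub_le` — summed over ANY finite set of base points, the total descent of the window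
  count along `v` is at most `#B · #(run tops)`: `∑_x (c(x) − c(x+v))₊ ≤ #B · R_v(X)`;
* `sum_card_runTops_levelSet_eq` — discrete COAREA: the total descent equals the number of `v`-run tops
  of the superlevel sets `{c > s}`, summed over the levels `s < #B`;
* `sum_card_runTops_levelSet_le` — hence the superlevel sets of the window count have, summed over
  the `#B` levels, at most `#B · R_v(X)` run tops in direction `v` ("on average no more broken bonds
  than `X` itself"), while `sum_card_levelSet_eq` records that their total size is exactly `#B · #X`
  (layer cake).

These are the two discrete inputs of the density form of the Brunn–Minkowski route to the sharp
constant `∛432 = 3 · 16^{1/3}` (the superlevel sets are then grown by the lattice Wulff zonotope and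
compared with the tree's Brunn–Minkowski inequality); see the seat memo `DensityBM.md` (item evidence on
stmt-Ventures-19145).  WHAT THIS IS NOT: anything about packings or about the crux itself.
-/

namespace Summit.Ventures.Crystal3D.Theorems

open Finset

variable {G : Type*} [AddCommGroup G] [DecidableEq G]

/-- One-step descent of the window count: `#(X ∩ (x+B)) ≤ #(X ∩ (x+v+B)) + #{b ∈ B : x+b ∈ X, x+b+v ∉ X}`.
Every window point of `X` either still lies in `X` after the shift by `v` or is a `v`-run top. -/
theorem card_filter_window_le (X B : Finset G) (v x : G) :
    (B.filter fun b => x + b ∈ X).card ≤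
      (B.filter fun b => x + v + b ∈ X).card +
        (B.filter fun b => x + b ∈ X.filter fun y => y + v ∉ X).card := by
  calc (B.filter fun b => x + b ∈ X).card
      ≤ ((B.filter fun b => x + v + b ∈ X) ∪
          (B.filter fun b => x + b ∈ X.filter fun y => y + v ∉ X)).card := by
        refine card_le_card fun b hb => ?_
        obtain ⟨hbB, hbX⟩ := mem_filter.1 hb
        rw [mem_union, mem_filter, mem_filter, mem_filter]
        by_cases h : x + b + v ∈ X
        · left
          refine ⟨hbB, ?_⟩
          rwa [add_right_comm] at h
        · right
          exact ⟨hbB, hbX, h⟩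
    _ ≤ _ := card_union_le _ _

/-- Summed over any finite set `S` of base points, the number of pairs `(x, b) ∈ S × B` with `x + b`
a `v`-run top is at most `#(run tops) · #B` (the map `(x,b) ↦ (x+b, b)` is injective). -/
theorem sum_card_filter_window_runTops_le (X B S : Finset G) (v : G) :
    ∑ x ∈ S, (B.filter fun b => x + b ∈ X.filter fun y => y + v ∉ X).card ≤
      B.card * (X.filter fun y => y + v ∉ X).card := by
  set T := X.filter fun y => y + v ∉ X with hT
  rw [← card_sigma, mul_comm, ← card_product]
  refine card_le_card_of_injOn (fun p => (p.1 + p.2, p.2)) (fun p hp => ?_) ?_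
  · rw [mem_coe, mem_sigma, mem_filter] at hp
    rw [mem_coe, mem_product]
    exact ⟨hp.2.2, hp.2.1⟩
  · intro p hp q hq hpq
    simp only [Prod.mk.injEq] at hpq
    obtain ⟨h1, h2⟩ := hpq
    rw [h2] at h1
    exact Sigma.ext (add_right_cancel h1) (heq_of_eq h2)

/-- TOTAL DESCENT BOUND.  For every finite set `S` of base points,
`∑_{x ∈ S} (c(x) − c(x+v))₊ ≤ #B · R_v(X)` where `c(x) = #{b ∈ B : x + b ∈ X}` is the window count and
`R_v(X) = #{y ∈ X : y + v ∉ X}` the number of `v`-run tops (truncated subtraction in `ℕ` is the positive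
part). -/
theorem sum_window_tsub_le (X B S : Finset G) (v : G) :
    ∑ x ∈ S, ((B.filter fun b => x + b ∈ X).card - (B.filter fun b => x + v + b ∈ X).card) ≤
      B.card * (X.filter fun y => y + v ∉ X).card := by
  refine le_trans (sum_le_sum fun x _ => ?_) (sum_card_filter_window_runTops_le X B S v)
  exact tsub_le_iff_left.2 (card_filter_window_le X B v x)

/-- The window count vanishes outside the finite set `X − B` of differences. -/
theorem card_filter_window_eq_zero (X B : Finset G) (x : G)
    (hx : x ∉ (X ×ˢ B).image fun p => p.1 - p.2) :
    (B.filter fun b => x + b ∈ X).card = 0 := by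
  rw [card_eq_zero, filter_eq_empty_iff]
  intro b hb hxb
  exact hx (mem_image.2 ⟨(x + b, b), mem_product.2 ⟨hxb, hb⟩, by simp⟩)

/-- The window count is at most `#B`. -/
theorem card_filter_window_le_card (X B : Finset G) (x : G) :
    (B.filter fun b => x + b ∈ X).card ≤ B.card :=
  card_filter_le _ _

/-- LAYER CAKE: summed over the support, the window counts add up to `#X · #B`. -/
theorem sum_card_filter_window_eq (X B : Finset G) :
    ∑ x ∈ (X ×ˢ B).image (fun p => p.1 - p.2), (B.filter fun b => x + b ∈ X).card =
      X.card * B.card := by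
  set S := (X ×ˢ B).image (fun p => p.1 - p.2) with hS
  rw [← card_sigma, ← card_product]
  refine card_nbij' (fun p => (p.1 + p.2, p.2)) (fun q => ⟨q.1 - q.2, q.2⟩) (fun p hp => ?_)
    (fun q hq => ?_) (fun p _ => ?_) (fun q _ => ?_)
  · rw [mem_coe, mem_sigma, mem_filter] at hp
    exact mem_coe.2 (mem_product.2 ⟨hp.2.2, hp.2.1⟩)
  · rw [mem_coe, mem_product] at hq
    rw [mem_coe, mem_sigma, mem_filter]
    exact ⟨mem_image.2 ⟨q, mem_product.2 hq, rfl⟩, hq.2, by rw [sub_add_cancel]; exact hq.1⟩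
  · simp
  · simp

/-- Double counting: `∑_{b ∈ T} #{a ∈ S : P a b} = ∑_{a ∈ S} #{b ∈ T : P a b}`. -/
theorem sum_card_filter_comm {α β : Type*} (S : Finset α) (T : Finset β) (P : α → β → Prop)
    [∀ a b, Decidable (P a b)] :
    ∑ b ∈ T, (S.filter fun a => P a b).card = ∑ a ∈ S, (T.filter fun b => P a b).card := by
  rw [← card_sigma, ← card_sigma]
  refine card_nbij' (fun p => ⟨p.2, p.1⟩) (fun q => ⟨q.2, q.1⟩) (fun p hp => ?_) (fun q hq => ?_)
    (fun _ _ => rfl) (fun _ _ => rfl)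
  · rw [mem_coe, mem_sigma, mem_filter] at hp
    rw [mem_coe, mem_sigma, mem_filter]
    exact ⟨hp.2.1, hp.1, hp.2.2⟩
  · rw [mem_coe, mem_sigma, mem_filter] at hq
    rw [mem_coe, mem_sigma, mem_filter]
    exact ⟨hq.2.1, hq.1, hq.2.2⟩

/-- Membership in the superlevel set `{x : s < c(x)}` (realised inside the support `X − B`). -/
theorem mem_levelSet_iff (X B : Finset G) (s : ℕ) (x : G) :
    x ∈ ((X ×ˢ B).image (fun p => p.1 - p.2)).filter
        (fun y => s < (B.filter fun b => y + b ∈ X).card) ↔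
      s < (B.filter fun b => x + b ∈ X).card := by
  rw [mem_filter]
  constructor
  · exact fun h => h.2
  · intro h
    refine ⟨?_, h⟩
    by_contra hx
    rw [card_filter_window_eq_zero X B x hx] at h
    exact Nat.not_lt_zero _ h

/-- LAYER CAKE for the superlevel sets: `∑_{s < #B} #{x : s < c(x)} = #X · #B`. -/
theorem sum_card_levelSet_eq (X B : Finset G) :
    ∑ s ∈ range B.card, (((X ×ˢ B).image (fun p => p.1 - p.2)).filter
        (fun y => s < (B.filter fun b => y + b ∈ X).card)).card = X.card * B.card := by
  set S := (X ×ˢ B).image (fun p => p.1 - p.2) with hS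
  rw [← sum_card_filter_window_eq X B,
    sum_card_filter_comm S (range B.card) (fun y s => s < (B.filter fun b => y + b ∈ X).card)]
  refine sum_congr rfl fun x _ => ?_
  have : (range B.card).filter (fun s => s < (B.filter fun b => x + b ∈ X).card) =
      range (B.filter fun b => x + b ∈ X).card := by
    ext s
    rw [mem_filter, mem_range, mem_range]
    constructor
    · exact fun h => h.2
    · exact fun h => ⟨lt_of_lt_of_le h (card_filter_le _ _), h⟩
  rw [this, card_range]

/-- DISCRETE COAREA.  The number of `v`-run tops of the superlevel sets `{c > s}`, summed over the levels
`s < #B`, equals the total descent `∑_x (c(x) − c(x+v))₊` of the window count over its support. -/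
theorem sum_card_runTops_levelSet_eq (X B : Finset G) (v : G) :
    ∑ s ∈ range B.card,
      ((((X ×ˢ B).image (fun p => p.1 - p.2)).filter
          (fun y => s < (B.filter fun b => y + b ∈ X).card)).filter
        fun x => x + v ∉ ((X ×ˢ B).image (fun p => p.1 - p.2)).filter
          (fun y => s < (B.filter fun b => y + b ∈ X).card)).card =
      ∑ x ∈ (X ×ˢ B).image (fun p => p.1 - p.2),
        ((B.filter fun b => x + b ∈ X).card - (B.filter fun b => x + v + b ∈ X).card) := by
  set S := (X ×ˢ B).image (fun p => p.1 - p.2) with hS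
  -- rewrite each level's run-top set as a filter of `S` by `c(x+v) ≤ s < c(x)`
  have hlev : ∀ s, ((S.filter (fun y => s < (B.filter fun b => y + b ∈ X).card)).filter
      fun x => x + v ∉ S.filter (fun y => s < (B.filter fun b => y + b ∈ X).card)) =
      S.filter fun x => (B.filter fun b => x + v + b ∈ X).card ≤ s ∧
        s < (B.filter fun b => x + b ∈ X).card := by
    intro s
    ext x
    simp only [mem_filter, not_and, not_lt]
    constructor
    · rintro ⟨⟨hxS, hsx⟩, h⟩
      refine ⟨hxS, ?_, hsx⟩
      by_cases hxv : x + v ∈ S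
      · exact h hxv
      · rw [card_filter_window_eq_zero X B (x + v) (hS ▸ hxv)]
        exact Nat.zero_le _
    · rintro ⟨hxS, hle, hsx⟩
      exact ⟨⟨hxS, hsx⟩, fun _ => hle⟩
  simp_rw [hlev]
  rw [sum_card_filter_comm S (range B.card) (fun x s =>
    (B.filter fun b => x + v + b ∈ X).card ≤ s ∧ s < (B.filter fun b => x + b ∈ X).card)]
  refine sum_congr rfl fun x _ => ?_
  have : (range B.card).filter (fun s => (B.filter fun b => x + v + b ∈ X).card ≤ s ∧
      s < (B.filter fun b => x + b ∈ X).card) =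
      Ico (B.filter fun b => x + v + b ∈ X).card (B.filter fun b => x + b ∈ X).card := by
    ext s
    rw [mem_filter, mem_range, mem_Ico]
    constructor
    · exact fun h => h.2
    · exact fun h => ⟨lt_of_lt_of_le h.2 (card_filter_le _ _), h⟩
  rw [this, Nat.card_Ico]

/-- COAREA BOUND (the input of the density Brunn–Minkowski route): summed over the `#B` levels, the
superlevel sets `{c > s}` of the window count have at most `#B · R_v(X)` run tops in direction `v`. -/
theorem sum_card_runTops_levelSet_le (X B : Finset G) (v : G) :
    ∑ s ∈ range B.card,
      ((((X ×ˢ B).image (fun p => p.1 - p.2)).filter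
          (fun y => s < (B.filter fun b => y + b ∈ X).card)).filter
        fun x => x + v ∉ ((X ×ˢ B).image (fun p => p.1 - p.2)).filter
          (fun y => s < (B.filter fun b => y + b ∈ X).card)).card ≤
      B.card * (X.filter fun y => y + v ∉ X).card := by
  rw [sum_card_runTops_levelSet_eq]
  exact sum_window_tsub_le X B _ v

end Summit.Ventures.Crystal3D.Theorems
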